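import Summits.CriticalPhenomena.PercolationContinuityZ3.Theorems.PercNearOneGluingNoHeavyQuantCritVolumeProduct
import Summits.CriticalPhenomena.PercolationContinuityZ3.Theorems.PercNearOneGluingNoHeavyLowerTailCSHTheoremOne
import Literature.Probability.Percolation.TriangleSusceptibilityDerivative
import HarnessLib

/-!
# Pointwise critical lower bounds in product form, II: the inverse reading, `δ = 2` POINTWISE under the triangle
# condition, the near-critical window, and the finite-cluster reading at `p_c` — quant lane, seat p4 gen 11

builds on p205010 (kernel theorem, internal audit signed; external expert review pending) — used only in §5
(`θ(p_c) = 0` for every `d ≥ 2`, `CSH.percolationContinuity_allDimensions`).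
Status sentence for p205010: "θ(p_c) = 0 on ℤ^d, all d ≥ 2 — kernel-verified (Lean 4/Mathlib, standard
axioms); internal adversarial audit SIGNED 2026-08-20 04:29Z; external expert review pending."

Sequel of `…QuantCritVolumeProduct.lean` (`CritProduct.real_clusterSizeGe_mul_sum_ge`:
`a_n · S_n ≥ p_c(1−p_c)/(256 d)`, `a_n = P_{p_c}(|C(0)| ≥ n)`, `S_n = Σ_{j≤n} a_j`).  Seat `prim-quant-p4`
(METHOD = differential inequalities near `p_c`), `--supports stmt-CriticalPhenomena-4575`; pure proofs, no definitions.

* **`real_clusterSizeGe_ge_of_sum_le`** — `S_n ≤ B` ⇒ `a_n ≥ p_c(1−p_c)/(256 d B)`: an UPPER bound on the truncated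
  mean forces a pointwise LOWER bound on the tail.
* **`real_clusterSizeGe_ge_inv_sqrt_of_le`** — `a_j ≤ B/√j` (all `j ≥ 1`) ⇒ `a_n ≥ (p_c(1−p_c)/(512 d B))/√n` (all `n ≥ 1`);
  hence **`clusterSizeGe_boundedRatio_of_gamma`**: under the triangle condition, granted Aizenman–Newman's `γ = 1`
  (named fact `AizenmanNewman1984_gamma_eq_one`; the upper half is the tree's `real_clusterSizeGe_criticalProb_le_of_gamma`,
  Hutchcroft 2022 §1.1), `δ = 2` POINTWISE in the bounded-ratio sense — the tree's `MeanFieldDelta.lean` had the upper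
  half only; Barsky–Aizenman 1991 prove the lower half by extrapolation — and UNCONDITIONALLY in the tree
  (**`clusterSizeGe_boundedRatio_of_triangle`**, `γ = 1` from `AizenmanNewman1984_gamma_eq_one_holds`): `δ = 2` pointwise,
  bounded-ratio sense, under `TriangleCondition d`, every `d ≥ 2` (printed: Heydenreich–van der Hofstad Thm. 9.2).
* **`real_clusterSizeGe_le_near_criticalProbI`** — the window: for `q ∈ (p_c,(1+p_c)/2]`,
  `P_q(|C| ≥ n) ≤ 2a_n + (32 d/(p_c(1−p_c))) (q−p_c)² S_n`.
* §5 **`real_finiteCluster_ge`** (p205010): `P_{p_c}(n ≤ |C(0)| < ∞) · S_n ≥ p_c(1−p_c)/(256 d)` and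
  `P_{p_c}(n ≤ |C(0)| < ∞) ≥ 1/(1024 d² n)`, every `d ≥ 2`, `n ≥ 1`.

HONEST: elementary consequences of Hutchcroft 2022 Thm. 1.3 (tree theorem) and the mean-field bound; the POINTWISE
`a_n ≥ c/√n` in general dimension is NOT claimed; nothing here is a rate for `θ`.

## References
* T. Hutchcroft, J. Stat. Phys. 189 (2022) no. 6, Thm. 1.3 and §1.1 [Hutchcroft2022Triangle].
* M. Heydenreich, R. van der Hofstad (2017), Thm. 4.1, §4.3 Cor. 4.5 [HeydenreichVanDerHofstad2017];
  D. J. Barsky, M. Aizenman, Ann. Probab. 19 (1991) [BarskyAizenman1991]; M. Aizenman, D. J. Barsky, Comm. Math.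
  Phys. 108 (1987), Thm. 1.2 [AizenmanBarsky1987].
-/

noncomputable section

namespace Summit.CriticalPhenomena.PercolationContinuityZ3.Theorems

namespace CritProduct

open MeasureTheory Set Filter Topology Literature.Probability.Percolation Literature.Probability.LatticeModels
open Literature.Probability.Entropy
open scoped Classical

variable {d : ℕ}

/-! ### §3. The inverse reading and the conditional pointwise halves -/

/-- **Inverse reading** of the product bound: an UPPER bound on the truncated mean forces a pointwise LOWER bound on
the tail — if `Σ_{j=1}^{n} P_{p_c}(|C| ≥ j) ≤ B` (`B > 0`) then `P_{p_c}(|C| ≥ n) ≥ p_c(1−p_c)/(256 d B)`.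
[cite: Hutchcroft2022Triangle, Thm. 1.3] -/
theorem real_clusterSizeGe_ge_of_sum_le (hd : 2 ≤ d) {n : ℕ} (hn : 1 ≤ n) {B : ℝ} (hB : 0 < B)
    (hS : ∑ j ∈ Finset.Icc 1 n, (bondPercolation (zdGraph d) (criticalProbI d)).real (clusterSizeGe (0 : Site d) j) ≤ B) :
    (criticalProbI d : ℝ) * (1 - criticalProbI d) / (256 * d * B) ≤
      (bondPercolation (zdGraph d) (criticalProbI d)).real (clusterSizeGe (0 : Site d) n) := by
  set S : ℝ := ∑ j ∈ Finset.Icc 1 n,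
    (bondPercolation (zdGraph d) (criticalProbI d)).real (clusterSizeGe (0 : Site d) j) with hSdef
  set a : ℝ := (bondPercolation (zdGraph d) (criticalProbI d)).real (clusterSizeGe (0 : Site d) n) with hadef
  have hprod := real_clusterSizeGe_mul_sum_ge hd hn
  rw [← hadef, ← hSdef] at hprod
  have ha0 : 0 ≤ a := measureReal_nonneg
  have hd2 : (2 : ℝ) ≤ d := by exact_mod_cast hd
  have hdpos : (0 : ℝ) < 256 * d := by linarith
  rw [div_le_iff₀ (by positivity)]
  calc (criticalProbI d : ℝ) * (1 - criticalProbI d) = (criticalProbI d : ℝ) * (1 - criticalProbI d) / (256 * d) * (256 * d) := by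
        field_simp
    _ ≤ a * S * (256 * d) := mul_le_mul_of_nonneg_right hprod hdpos.le
    _ ≤ a * B * (256 * d) := by gcongr
    _ = a * (256 * d * B) := by ring

/-- **Pointwise lower half of `δ = 2` from its upper half.**  If `P_{p_c}(|C(0)| ≥ j) ≤ B/√j` for all `j ≥ 1`
(`B > 0`), then `P_{p_c}(|C(0)| ≥ n) ≥ (p_c(1−p_c)/(512 d B))/√n` for all `n ≥ 1` (`S_n ≤ 2B√n`).  On `ℤ^d` the
hypothesis is the Barsky–Aizenman upper bound (under the triangle condition); the conclusion is then `δ = 2`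
POINTWISE in the bounded-ratio sense.  [cite: Hutchcroft2022Triangle, Thm. 1.3 and §1.1]
[cite: HeydenreichVanDerHofstad2017, Thm. 4.1 with (1.2.10)] -/
theorem real_clusterSizeGe_ge_inv_sqrt_of_le (hd : 2 ≤ d) {B : ℝ} (hB : 0 < B)
    (hup : ∀ j : ℕ, 1 ≤ j →
      (bondPercolation (zdGraph d) (criticalProbI d)).real (clusterSizeGe (0 : Site d) j) ≤ B / Real.sqrt j)
    {n : ℕ} (hn : 1 ≤ n) :
    (criticalProbI d : ℝ) * (1 - criticalProbI d) / (512 * d * B) / Real.sqrt n ≤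
      (bondPercolation (zdGraph d) (criticalProbI d)).real (clusterSizeGe (0 : Site d) n) := by
  have hn0 : (0 : ℝ) < n := by exact_mod_cast hn
  have hsq0 : 0 < Real.sqrt n := Real.sqrt_pos.2 hn0
  have hS : ∑ j ∈ Finset.Icc 1 n, (bondPercolation (zdGraph d) (criticalProbI d)).real (clusterSizeGe (0 : Site d) j) ≤
      2 * B * Real.sqrt n := by
    calc ∑ j ∈ Finset.Icc 1 n, (bondPercolation (zdGraph d) (criticalProbI d)).real (clusterSizeGe (0 : Site d) j)
        ≤ ∑ j ∈ Finset.Icc 1 n, B / Real.sqrt j := Finset.sum_le_sum fun j hj => hup j (Finset.mem_Icc.1 hj).1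
      _ = B * ∑ j ∈ Finset.Icc 1 n, (1 / Real.sqrt j : ℝ) := by rw [Finset.mul_sum]; simp [div_eq_mul_inv]
      _ ≤ B * (2 * Real.sqrt n) := mul_le_mul_of_nonneg_left (sum_Icc_inv_sqrt_le n) hB.le
      _ = 2 * B * Real.sqrt n := by ring
  have h := real_clusterSizeGe_ge_of_sum_le hd hn (by positivity) hS
  have hd2 : (2 : ℝ) ≤ d := by exact_mod_cast hd
  have hdpos : (0 : ℝ) < 512 * d := by linarith
  calc (criticalProbI d : ℝ) * (1 - criticalProbI d) / (512 * d * B) / Real.sqrt n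
      = (criticalProbI d : ℝ) * (1 - criticalProbI d) / (256 * d * (2 * B * Real.sqrt n)) := by
        field_simp; ring
    _ ≤ _ := h

/-- **`δ = 2` pointwise, bounded-ratio sense, under the triangle condition** (granted Aizenman–Newman's `γ = 1`,
named fact `AizenmanNewman1984_gamma_eq_one`): `c/√n ≤ P_{p_c}(|C(0)| ≥ n) ≤ C/√n` for all `n ≥ 1`.  The upper half
is the tree's `real_clusterSizeGe_criticalProb_le_of_gamma` (Hutchcroft 2022 §1.1); the lower half is new as a
POINTWISE statement obtained this way (Barsky–Aizenman 1991 prove it by the extrapolation method).  CONDITIONAL on the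
named fact.  [cite: Hutchcroft2022Triangle, §1.1 (Thm. 1.3 and the sentence following it)]
[cite: HeydenreichVanDerHofstad2017, Thm. 4.1 with (1.2.10)] -/
theorem clusterSizeGe_boundedRatio_of_gamma (h₁ : AizenmanNewman1984_gamma_eq_one) (hd : 2 ≤ d)
    (hT : TriangleCondition d) :
    ∃ c C : ℝ, 0 < c ∧ ∀ n : ℕ, 1 ≤ n →
      c / Real.sqrt n ≤ (bondPercolation (zdGraph d) (criticalProbI d)).real (clusterSizeGe (0 : Site d) n) ∧
        (bondPercolation (zdGraph d) (criticalProbI d)).real (clusterSizeGe (0 : Site d) n) ≤ C / Real.sqrt n := by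
  obtain ⟨C, hC⟩ := real_clusterSizeGe_criticalProb_le_of_gamma h₁ hd hT
  have hd1 : 1 ≤ d := by omega
  have hpc0 : 0 < (criticalProbI d : ℝ) := criticalProb_zd_pos d hd1
  have hpc1 : (criticalProbI d : ℝ) < 1 := criticalProb_zd_lt_one hd
  -- `C ≥ 1 > 0` since `a_1 = 1`
  have hC1 : 1 ≤ C := by
    have := hC 1 le_rfl
    rw [real_clusterSizeGe_one, Nat.cast_one, Real.sqrt_one, div_one] at this
    exact this
  have hC0 : 0 < C := by linarith
  refine ⟨(criticalProbI d : ℝ) * (1 - criticalProbI d) / (512 * d * C), C, by positivity, fun n hn => ⟨?_, hC n hn⟩⟩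
  exact real_clusterSizeGe_ge_inv_sqrt_of_le hd hC0 hC hn

/-- **`δ = 2` POINTWISE in the bounded-ratio sense under the triangle condition, every `d ≥ 2`, UNCONDITIONAL in the
tree**: `c/√n ≤ P_{p_c}(|C(0)| ≥ n) ≤ C/√n` for all `n ≥ 1`, with Aizenman–Newman's `γ = 1` supplied by the tree's
`AizenmanNewman1984_gamma_eq_one_holds` (Hutchcroft's Prop. 1.6/1.7 route).  Printed: Heydenreich–van der Hofstad Thm. 9.2
(Aizenman–Newman / Barsky–Aizenman under the triangle condition); here the lower half comes from the product bound, a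
different route.  [cite: HeydenreichVanDerHofstad2017, Thm. 9.2 and Thm. 4.1 with (1.2.10)] [cite: BarskyAizenman1991, main theorem (δ = 2)] -/
theorem clusterSizeGe_boundedRatio_of_triangle (hd : 2 ≤ d) (hT : TriangleCondition d) :
    ∃ c C : ℝ, 0 < c ∧ ∀ n : ℕ, 1 ≤ n →
      c / Real.sqrt n ≤ (bondPercolation (zdGraph d) (criticalProbI d)).real (clusterSizeGe (0 : Site d) n) ∧
        (bondPercolation (zdGraph d) (criticalProbI d)).real (clusterSizeGe (0 : Site d) n) ≤ C / Real.sqrt n :=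
  clusterSizeGe_boundedRatio_of_gamma AizenmanNewman1984_gamma_eq_one_holds hd hT

/-! ### §4. The window reading: how far above `p_c` the critical tail persists -/

/-- **Upper window.**  For `q ∈ (p_c, (1+p_c)/2]`: `P_q(|C(0)| ≥ n) ≤ 2 P_{p_c}(|C(0)| ≥ n) + (32 d/(p_c(1−p_c))) (q−p_c)² S_n`
— the critical volume tail controls the slightly supercritical one (and in particular `θ(q)`) up to the scale
`q − p_c ≍ (a_n/S_n)^{1/2}` (mean field: `n^{-1/2}`).  [cite: Hutchcroft2022Triangle, Thm. 1.3] -/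
theorem real_clusterSizeGe_le_near_criticalProbI (hd : 2 ≤ d) (n : ℕ) (q : unitInterval)
    (hq : (criticalProbI d : ℝ) < q) (hq2 : (q : ℝ) ≤ (1 + criticalProbI d) / 2) :
    (bondPercolation (zdGraph d) q).real (clusterSizeGe (0 : Site d) n) ≤
      2 * (bondPercolation (zdGraph d) (criticalProbI d)).real (clusterSizeGe (0 : Site d) n) +
        32 * d / ((criticalProbI d : ℝ) * (1 - criticalProbI d)) * ((q : ℝ) - criticalProbI d) ^ 2 *
          ∑ j ∈ Finset.Icc 1 n, (bondPercolation (zdGraph d) (criticalProbI d)).real (clusterSizeGe (0 : Site d) j) := by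
  have hd1 : 1 ≤ d := by omega
  set pc : ℝ := (criticalProbI d : ℝ) with hpcdef
  have hpc0 : 0 < pc := criticalProb_zd_pos d hd1
  have hpc1 : pc < 1 := criticalProb_zd_lt_one hd
  have hq0 : 0 < (q : ℝ) := hpc0.trans hq
  have hq1 : (q : ℝ) < 1 := by linarith
  have hv0 : 0 < pc * (1 - pc) := mul_pos hpc0 (by linarith)
  set S : ℝ := ∑ j ∈ Finset.Icc 1 n,
    (bondPercolation (zdGraph d) (criticalProbI d)).real (clusterSizeGe (0 : Site d) j) with hSdef
  have hS0 : 0 ≤ S := Finset.sum_nonneg fun j _ => measureReal_nonneg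
  have hH := ClusterExploration.real_clusterSizeGe_le_of_kl (G := zdGraph d) (n := n) degree_zdGraph_le
    (0 : Site d) (criticalProbI d) q hpc0 hpc1 hq0 hq1
  rw [← hSdef] at hH
  have hkl : binaryKL pc q ≤ ((q : ℝ) - pc) ^ 2 / ((q : ℝ) * (1 - q)) := by
    have := QuantitativeBGNKlTransfer.binaryKL_le_sq_div hpc0.le hpc1.le hq0 hq1
    rwa [show (pc - q) ^ 2 = ((q : ℝ) - pc) ^ 2 by ring] at this
  have hqq : pc * (1 - pc) / 2 ≤ (q : ℝ) * (1 - q) := by nlinarith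
  have hkl' : binaryKL pc q ≤ 2 * ((q : ℝ) - pc) ^ 2 / (pc * (1 - pc)) := by
    refine hkl.trans ?_
    rw [div_le_div_iff₀ (by nlinarith) hv0]
    nlinarith [sq_nonneg ((q : ℝ) - pc)]
  calc (bondPercolation (zdGraph d) q).real (clusterSizeGe (0 : Site d) n)
      ≤ 2 * (bondPercolation (zdGraph d) (criticalProbI d)).real (clusterSizeGe (0 : Site d) n) +
          8 * ((2 * d : ℕ) : ℝ) * binaryKL pc q * S := hH
    _ ≤ 2 * (bondPercolation (zdGraph d) (criticalProbI d)).real (clusterSizeGe (0 : Site d) n) +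
          8 * ((2 * d : ℕ) : ℝ) * (2 * ((q : ℝ) - pc) ^ 2 / (pc * (1 - pc))) * S := by
        gcongr
    _ = _ := by push_cast; field_simp; ring

/-- **Intrinsic finite-size transfer for `θ` (volume form).**  For `q ∈ (p_c,(1+p_c)/2]` and every `n`:
`θ(q) ≤ 2 P_{p_c}(|C(0)| ≥ n) + (32 d/(p_c(1−p_c))) (q−p_c)² E_{p_c}[|C(0)| ∧ n]` (`θ(q) ≤ P_q(|C| ≥ n)` and the window).
Compare Newman's `θ(p_c+s) ≤ 2M(p_c, A₁s²)` (tree): same scaling, generating-function form.  [cite: Hutchcroft2022Triangle, Thm. 1.3] -/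
theorem theta_le_two_mul_add_volume (hd : 2 ≤ d) (n : ℕ) (q : unitInterval)
    (hq : (criticalProbI d : ℝ) < q) (hq2 : (q : ℝ) ≤ (1 + criticalProbI d) / 2) :
    theta (zdGraph d) 0 q ≤
      2 * (bondPercolation (zdGraph d) (criticalProbI d)).real (clusterSizeGe (0 : Site d) n) +
        32 * d / ((criticalProbI d : ℝ) * (1 - criticalProbI d)) * ((q : ℝ) - criticalProbI d) ^ 2 *
          ∑ j ∈ Finset.Icc 1 n, (bondPercolation (zdGraph d) (criticalProbI d)).real (clusterSizeGe (0 : Site d) j) :=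
  le_trans (measureReal_mono (percolatesAt_subset_clusterSizeGe (0 : Site d) n))
    (real_clusterSizeGe_le_near_criticalProbI hd n q hq hq2)

/-! ### §5. The finite-cluster reading at `p_c` (uses p205010: `θ(p_c) = 0` for every `d ≥ 2`) -/

/-- At `p_c` every cluster is finite almost surely (p205010, `CSH.percolationContinuity_allDimensions`), so the tail of
the FINITE critical cluster satisfies the same bounds: `P_{p_c}(n ≤ |C(0)| < ∞) = P_{p_c}(|C(0)| ≥ n)`.
builds on p205010 (kernel theorem, internal audit signed; external expert review pending).
[cite: Hutchcroft2022Triangle, Thm. 1.3] -/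
theorem real_clusterSizeGe_diff_percolatesAt (hd : 2 ≤ d) (n : ℕ) :
    (bondPercolation (zdGraph d) (criticalProbI d)).real (clusterSizeGe (0 : Site d) n \ percolatesAt 0) =
      (bondPercolation (zdGraph d) (criticalProbI d)).real (clusterSizeGe (0 : Site d) n) := by
  have hθ : (bondPercolation (zdGraph d) (criticalProbI d)) (percolatesAt (0 : Site d)) = 0 := by
    have h0 : theta (zdGraph d) (0 : Site d) (criticalProbI d) = 0 := CSH.percolationContinuity_allDimensions d hd
    rwa [theta, measureReal_eq_zero_iff] at h0
  rw [measureReal_def, measureReal_def, measure_sdiff_null hθ]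

/-- **The finite critical cluster is at least mean-field large, pointwise in product form** (every `d ≥ 2`, `n ≥ 1`):
`P_{p_c}(n ≤ |C(0)| < ∞) · Σ_{j=1}^{n} P_{p_c}(|C(0)| ≥ j) ≥ p_c(1−p_c)/(256 d)` and `P_{p_c}(n ≤ |C(0)| < ∞) ≥ 1/(1024 d² n)`.
builds on p205010 (kernel theorem, internal audit signed; external expert review pending).
[cite: Hutchcroft2022Triangle, Thm. 1.3] [cite: AizenmanBarsky1987, Thm. 1.2 ((1.10))] -/
theorem real_finiteCluster_ge (hd : 2 ≤ d) {n : ℕ} (hn : 1 ≤ n) :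
    (criticalProbI d : ℝ) * (1 - criticalProbI d) / (256 * d) ≤
      (bondPercolation (zdGraph d) (criticalProbI d)).real (clusterSizeGe (0 : Site d) n \ percolatesAt 0) *
        ∑ j ∈ Finset.Icc 1 n, (bondPercolation (zdGraph d) (criticalProbI d)).real (clusterSizeGe (0 : Site d) j) ∧
    1 / (1024 * (d : ℝ) ^ 2 * n) ≤
      (bondPercolation (zdGraph d) (criticalProbI d)).real (clusterSizeGe (0 : Site d) n \ percolatesAt 0) := by
  rw [real_clusterSizeGe_diff_percolatesAt hd n]
  exact ⟨real_clusterSizeGe_mul_sum_ge hd hn, real_clusterSizeGe_criticalProbI_ge_div' hd hn⟩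

end CritProduct

end Summit.CriticalPhenomena.PercolationContinuityZ3.Theorems

end
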